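import Mathlib
import HarnessLib
import Summits.CriticalPhenomena.PercolationContinuityZ3.Theorems.PercNearOneGluingNoHeavyQuantFarDecChain
import Summits.CriticalPhenomena.PercolationContinuityZ3.Theorems.PercNearOneGluingNoHeavyQuantFarDecStep
import Summits.CriticalPhenomena.PercolationContinuityZ3.Theorems.PercNearOneGluingNoHeavyQuantFarDecRatio
import Summits.CriticalPhenomena.PercolationContinuityZ3.Theorems.PercNearOneGluingNoHeavyQuantFarDecLawStep

/-!
# QUANT lane R8, front "FAR beyond trees", layer one — CYC-DEC at the law level, file 5: **THE THEOREM**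
# `TwoChain.cycDec`: for every two-reversed-chain system with hub loads (every pendant cycle with any number of loaded
# vertices carrying arbitrary pendant structures), the block numbers dominate a mixture of the fully decoupled block and the
# exit point `(q, q)` for every `q ≤ min_i m_iu_i`

builds on p205010 (kernel theorem, internal audit signed; external expert review pending)

Support file (`--supports stmt-CriticalPhenomena-4575`), seat `prim-quant-p1` (gen 21); memo
`run/shared/lean/prim/quant/prim-quant-p1-g21/FOR-LEAD-CYCDEC.md` §5–§6.  Standard axioms; no sorries; no definitions.

PROOF (memo §5).  Induction on the number of hubs.  The system of hubs `2..n+1` is `C.shift`; by induction its numbers dominate a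
mixture of its decoupled numbers and `(q,q)`; adding the independent copy of hub 1 (`Block.dominates_noise`, g20 file) turns this into
"`S^(1)` dominates a mixture of `S^⊥` and `(q,q)`"; the one-vertex decoupling step `Block.dominates_hubStep` (`T/…QuantFarDecStep`)
gives "`S` dominates a mixture of `S^(1)` and `(q,q)`" once its hypothesis (C) is supplied — and (C) is `Block.ratio_C`
(`T/…QuantFarDecRatio`) instantiated with the per-position data of `C.shift` (`TwoChain.ratioC_shift` below, hypotheses from
`T/…QuantFarDecLawBounds/Sums`, identities and model facts from `T/…QuantFarDecLawStep`); `Block.dominates_trans` composes.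
One hub: the numbers coincide (`hh_one`, `tt_one`).

CONSEQUENCE (memo §5, to be wired at graph level by the k-hub transfer, memo §6(5)): the k-anchor conjecture CYC-DEC of p1 g19 §6 /
p1 g20 §0 — every pendant cycle block, with any number of loaded vertices, passes the block test with the virtual exit point — hence,
with `Block.real_card_le_one_le_of_dominates` (p1 g19 K3), FAR at layer one on every cactus.
[this work]
-/

namespace Summit.CriticalPhenomena.PercolationContinuityZ3.Theorems

namespace Quant

namespace Block

namespace TwoChain

open Finset

variable {C : TwoChain} {n : ℕ}

/-- **Hypothesis (C) of the hub step, for the concrete law** (memo §3–§4): `Block.ratio_C` instantiated with the per-position data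
of `D = C.shift` (`n` hubs, valid), boost `b = C.B 1 ≤ D.B 1`, factor `κ = 1 − C.A 1`, and any exit value `q ≤ m₂u₂`:
`π·q·omH n D ≤ σ·tt n D·(1 − q)` with `σ, π` the closed-form covariances of `T/…QuantFarDecLawStep`. [this work] -/
theorem ratioC_shift (hV : C.Valid (n + 1)) (q : ℝ) (hq : q ≤ C.m 2 * C.u 2) :
    ((1 - C.A 1) * (GZ n C.shift + GS n C.shift + C.B 1 * ((1 - ZF n C.shift - SF n C.shift) - TT n C.shift)))
        * q * omH n C.shift
      ≤ ((1 - C.A 1) * (DN n C.shift + C.B 1 * (omH n C.shift - ZF n C.shift))) * TT n C.shift * (1 - q) := by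
  have hD : C.shift.Valid n := hV.shift
  set D := C.shift with hDdef
  have hmem : ∀ f ∈ range n, f + 1 ≤ n := fun f hf => by simpa using hf
  have key := ratio_C (range n) (fun f => D.w (f + 1)) (fun f => ZQ n (f + 1) D) (fun f => SQ n (f + 1) D)
    (fun f => 1 - ZQ n (f + 1) D - SQ n (f + 1) D) (fun f => g1 (f + 1) D) (fun f => g2 (f + 1) D)
    (fun f => ZF (f + 1) D) (fun f => 1 - ZF (f + 1) D - SF (f + 1) D)
    (D.A 1) (D.u 1) (D.z 1) (D.B 1) (ZF n D) (1 - ZF n D - SF n D)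
    (fun f _ => w_nonneg hD _) (sum_w hD) (hD.B_nonneg 1) (hD.B_le_one 1) (hD.A_nonneg 1) (hD.A_le_one 1)
    (u_nonneg hD 1) (u_le_one hD 1) (u_add_z hD 1)
    (fun f _ => ZQ_nonneg hD _ _) (fun f _ => SQ_nonneg hD _ _)
    (fun f _ => by have := ZQ_add_SQ_le_one hD n (f + 1); linarith)
    (fun f _ => g1_nonneg hD _) (fun f _ => g2_nonneg hD _) (fun f _ => ZF_nonneg hD _)
    (fun f _ => by have := ZF_add_SF_le_one hD (f + 1); linarith)
    (fun f _ => g1_succ_ge hD f) (fun f _ => g1_le hD (f + 1)) (fun f _ => g2_le hD (f + 1))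
    (fun f _ => ZF_succ_le_z hD f)
    (fun f hf => ZF_split n (f + 1) (hmem f hf) D)
    (fun f hf => by rw [ZF_split n (f + 1) (hmem f hf) D, SF_split n (f + 1) (hmem f hf) D]; ring)
    (ZF_nonneg hD n) (by have := ZF_add_SF_le_one hD n; linarith)
    (GZ n D + GS n D) (DN n D) (omH n D) (TT n D)
    (by unfold GZ GS; rw [← sum_add_distrib]; apply sum_congr rfl; intro f _; ring)
    (by unfold DN; apply sum_congr rfl; intro f _; ring)
    (by
      unfold omH PE DN
      rw [add_sub_assoc, ← sum_sub_distrib]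
      congr 1; apply sum_congr rfl; intro f _; ring)
    (by
      unfold TT GZ GS PE PS
      rw [← sum_w hD]
      have e : ∀ f ∈ range n, D.w (f + 1) * (ZQ n (f + 1) D * g2 (f + 1) D + SQ n (f + 1) D * g1 (f + 1) D
          + (1 - ZQ n (f + 1) D - SQ n (f + 1) D))
          = D.w (f + 1) * ZQ n (f + 1) D * g2 (f + 1) D + D.w (f + 1) * SQ n (f + 1) D * g1 (f + 1) D
            + D.w (f + 1) - D.w (f + 1) * ZQ n (f + 1) D - D.w (f + 1) * SQ n (f + 1) D := by
        intro f _; ring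
      rw [sum_congr rfl e, sum_sub_distrib, sum_sub_distrib, sum_add_distrib, sum_add_distrib]
      ring)
    (C.B 1) (hV.B_nonneg 1) (hV.B_mono 1) q (1 - C.A 1)
    (by
      have e : (D.B 1 + (1 - D.B 1) * D.A 1) * D.u 1 = C.m 2 * C.u 2 := by
        simp only [hDdef, shift_B, shift_A, shift_u]; unfold m; ring
      rw [e]; exact hq)
    (by linarith [hV.A_le_one 1])
  -- `key` is literally the claim
  simpa only [hDdef] using key

/-- **THEOREM (CYC-DEC, law level; memo §5).**  For every valid two-reversed-chain system with hub loads on `n` hubs and every exit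
value `0 ≤ q ≤ m_iu_i` (all hubs `i`), the block numbers `(hh, tt)` dominate a mixture of the decoupled numbers `(hProd, tProd)` and
`(q, q)`: `∃ λ ∈ [0,1], λ·hProd + (1−λ)q ≤ hh ∧ λ·tProd + (1−λ)q ≤ tt`.  In particular every pendant cycle block with any number of
loaded vertices passes the k-anchor test of p1 g19 §6 (conjecture CYC-DEC) — the input of FAR at layer one on all cacti. [this work] -/
theorem cycDec : ∀ (n : ℕ) (C : TwoChain), C.Valid n → ∀ q : ℝ, 0 ≤ q → (∀ i, i < n → q ≤ C.m (i + 1) * C.u (i + 1)) →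
    ∃ l : ℝ, 0 ≤ l ∧ l ≤ 1 ∧ l * hProd n C + (1 - l) * q ≤ hh n C ∧ l * tProd n C + (1 - l) * q ≤ tt n C := by
  intro n
  induction n with
  | zero =>
    intro C hV q _ _
    have hB : C.B 1 = 1 := hV.B_succ
    refine ⟨1, zero_le_one, le_rfl, ?_, ?_⟩
    · unfold hh omH PE DN; simp [hB]
    · unfold tt TT GZ GS PE PS; simp [hB]
  | succ k ih =>
    intro C hV q hq0 hq
    have hq1 : q ≤ C.m 1 * C.u 1 := hq 0 (Nat.succ_pos k)
    rcases Nat.eq_zero_or_pos k with hk | hk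
    · -- one hub: the numbers coincide
      subst hk
      exact dominates_of_le q _ _ _ _ (le_of_eq (hh_one hV).symm) (le_of_eq (tt_one hV).symm)
    · -- k ≥ 1 hubs remain after removing hub 1
      have hD : C.shift.Valid k := hV.shift
      -- induction hypothesis for the tail, same exit value
      have hqD : ∀ i, i < k → q ≤ C.shift.m (i + 1) * C.shift.u (i + 1) := by
        intro i hi
        rw [shift_m, shift_u]
        exact hq (i + 1) (by omega)
      obtain ⟨l₂, hl₂0, hl₂1, hh₂, ht₂⟩ := ih C.shift hD q hq0 hqD
      -- noise: add the independent copy of hub 1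
      have hmu0 : 0 ≤ C.m 1 * C.u 1 := mul_nonneg (m_nonneg hV 1) (u_nonneg hV 1)
      have hmu1 : C.m 1 * C.u 1 ≤ 1 := by
        have := mul_le_mul (m_le_one hV 1) (u_le_one hV 1) (u_nonneg hV 1) zero_le_one; linarith
      have hq1' : q ≤ 1 := le_trans hq1 hmu1
      have H₂ := dominates_noise q (hh k C.shift) (tt k C.shift) (hProd k C.shift) (tProd k C.shift)
        (1 - C.m 1 * C.u 1) (C.m 1 * C.s 1) (C.m 1 * C.d 1) (by linarith)
        (mul_nonneg (m_nonneg hV 1) (hV.s_nonneg 1)) (mul_nonneg (m_nonneg hV 1) (hV.d_nonneg 1))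
        (by unfold u; ring) hq1' ⟨l₂, hl₂0, hl₂1, hh₂, ht₂⟩
      -- the one-vertex decoupling step
      have hq2 : q ≤ C.m 2 * C.u 2 := hq 1 (by omega)
      have hC := ratioC_shift hV q hq2
      obtain ⟨k', rfl⟩ : ∃ k', k = k' + 1 := ⟨k - 1, by omega⟩
      have hqH : q ≤ hh (k' + 1) C.shift := by
        have := mu_le_hh hD
        rw [shift_m, shift_u] at this
        exact le_trans hq2 this
      have H₁ := dominates_hubStep (C.m 1) (C.u 1) (C.s 1) (C.d 1) q (hh (k' + 1) C.shift) (tt (k' + 1) C.shift)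
        ((1 - C.A 1) * (DN (k' + 1) C.shift + C.B 1 * (omH (k' + 1) C.shift - ZF (k' + 1) C.shift)))
        ((1 - C.A 1) * (GZ (k' + 1) C.shift + GS (k' + 1) C.shift
          + C.B 1 * ((1 - ZF (k' + 1) C.shift - SF (k' + 1) C.shift) - TT (k' + 1) C.shift)))
        (hh (k' + 1 + 1) C) (tt (k' + 1 + 1) C)
        (m_nonneg hV 1) (m_le_one hV 1) (hV.s_nonneg 1) (hV.d_nonneg 1) (by unfold u; ring) (u_le_one hV 1)
        hq0 hqH
        (by have := omH_nonneg hD; unfold hh; linarith)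
        (TT_nonneg hD)
        (by have := TT_le hD; unfold hh tt; linarith)
        (sigma_nonneg hV)
        (by have := sigma_le hV; unfold hh; linarith)
        (pi_nonneg hV)
        (by have := hC; unfold hh tt; linarith)
        (by rw [hh_succ_eq hV])
        (by rw [tt_succ_eq hV])
        (tt_shift_le hV)
        (by rw [min_eq_right hq1]; exact le_trans hq1 (mu_le_hh hV))
        (mu_hh_le_tt hV)
      rw [min_eq_right hq1] at H₁
      -- compose: S ≽ (S^(1), q) and S^(1) ≽ (S^⊥, q)
      have H₂' : ∃ l : ℝ, 0 ≤ l ∧ l ≤ 1 ∧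
          l * hProd (k' + 1 + 1) C + (1 - l) * q ≤ C.m 1 * C.u 1 + (1 - C.m 1 * C.u 1) * hh (k' + 1) C.shift ∧
          l * tProd (k' + 1 + 1) C + (1 - l) * q
            ≤ C.m 1 * C.d 1 + C.m 1 * C.s 1 * hh (k' + 1) C.shift + (1 - C.m 1 * C.u 1) * tt (k' + 1) C.shift := by
        obtain ⟨l, hl0, hl1, h1, h2⟩ := H₂
        refine ⟨l, hl0, hl1, ?_, ?_⟩
        · rw [hProd_succ]; linarith
        · rw [tProd_succ]; linarith
      exact dominates_trans q _ _ _ _ _ _ H₁ H₂'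

/-- **CYC-DEC at the least delivery probability** (the form used by the k-anchor programme): with `q = m_{j+1}u_{j+1}` for a hub
`j + 1` minimising `m_iu_i` (the hypothesis is vacuous unless `j + 1 ≤ n`). [this work] -/
theorem cycDec_min (n : ℕ) (C : TwoChain) (hV : C.Valid n) (j : ℕ)
    (hmin : ∀ i, i < n → C.m (j + 1) * C.u (j + 1) ≤ C.m (i + 1) * C.u (i + 1)) :
    ∃ l : ℝ, 0 ≤ l ∧ l ≤ 1 ∧ l * hProd n C + (1 - l) * (C.m (j + 1) * C.u (j + 1)) ≤ hh n C ∧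
      l * tProd n C + (1 - l) * (C.m (j + 1) * C.u (j + 1)) ≤ tt n C :=
  cycDec n C hV _ (mul_nonneg (m_nonneg hV _) (u_nonneg hV _)) hmin

/-- **The (U)-form of p1 g20 §0** as a corollary: `t ≥ min(t^⊥, q)` for every admissible exit value `q` (and likewise
`h ≥ min(h^⊥, q)`). [this work] -/
theorem tt_ge_min (n : ℕ) (C : TwoChain) (hV : C.Valid n) (q : ℝ) (hq0 : 0 ≤ q)
    (hq : ∀ i, i < n → q ≤ C.m (i + 1) * C.u (i + 1)) :
    min (tProd n C) q ≤ tt n C ∧ min (hProd n C) q ≤ hh n C := by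
  obtain ⟨l, hl0, hl1, h1, h2⟩ := cycDec n C hV q hq0 hq
  constructor
  · have a := min_le_left (tProd n C) q
    have b := min_le_right (tProd n C) q
    nlinarith [mul_le_mul_of_nonneg_left a hl0, mul_le_mul_of_nonneg_left b (sub_nonneg.mpr hl1)]
  · have a := min_le_left (hProd n C) q
    have b := min_le_right (hProd n C) q
    nlinarith [mul_le_mul_of_nonneg_left a hl0, mul_le_mul_of_nonneg_left b (sub_nonneg.mpr hl1)]

end TwoChain

end Block

end Quant

end Summit.CriticalPhenomena.PercolationContinuityZ3.Theorems
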